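import Literature.Algebra.Homology.LefschetzNumberTriangle
import Literature.Algebra.Homology.CharpolyHomologyShortExact
import HarnessLib

/-!
# Characteristic polynomials on cohomology are multiplicative on distinguished triangles of `K(Vect_K)`

Layer `Literature/Algebra/Homology` (pure linear algebra over Mathlib; proved theorems only, 0 definitions, 0 named facts, no instances,
no notation). Rows `EulerCharacteristicTriangle` (`χ_H`) and `LefschetzNumberTriangle` (`Λ_K`) treat a distinguished triangle `T` of Mathlib's
`HomotopyCategory (ModuleCat K) (ComplexShape.up ℤ)` with an endomorphism `e : T ⟶ T`; this file is the CHARACTERISTIC-POLYNOMIAL member of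
the family (Görtz–Wedhorn II Rem. 23.62 (2) for the Euler–Poincaré map `u ↦ χ(u) ∈ K(X)ˣ`, Lang XX §3). Writing `χ(u) ∈ K[X]` for a
characteristic polynomial and `Hⁿ = HomotopyCategory.homologyFunctor _ _ n`, in the rational function field `RatFunc K`:

  **`finprod_charpoly_homologyFunctor_hom₂_eq : ∏ᶠ n, χ(Hⁿ(e.hom₂))^{(−1)ⁿ} = (∏ᶠ n, χ(Hⁿ(e.hom₁))^{(−1)ⁿ}) · ∏ᶠ n, χ(Hⁿ(e.hom₃))^{(−1)ⁿ}`**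

for finite-dimensional cohomology (hypotheses stated on `(Hⁿ).obj T.objᵢ`, dischargeable by row `HomotopyCategoryLefschetzNumber`'s
`moduleFinite_homologyFunctor_obj`) finitely supported on `T.obj₁`, `T.obj₃`. Proof: the long exact sequence of the homological functor `H⁰`
(Mathlib `Functor.homologySequence_exact₁/₂/₃`, `homologySequenceδ_naturality`) carries the endomorphism `(Hⁿ(e₁), Hⁿ(e₂), Hⁿ(e₃))`; each
term splits its characteristic polynomial over the two adjacent images (row `CharpolyHomologySequence`'s `charpoly_τ₂_eq_of_exact`, BY NAME
×3), and the connecting-map factors cancel in pairs `n ↔ n+1` by row `EulerPoincarePrinciple`'s `finprod_zpow_χ_eq_of_degreewise` in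
`(RatFunc K)ˣ` (BY NAME). Rows `EulerCharacteristicTriangle` / `LefschetzNumberTriangle` (its `natDegree` / `nextCoeff` shadows) are NOT
restated or re-derived. Library only (cell `pub-hodge-ring2`, count-neutral); proves nothing about any crux, route or conjecture.

## References

* U. Görtz, T. Wedhorn, *Algebraic Geometry II* (2023), Remark 23.62 (2). [GortzWedhorn2023]
* S. Lang, *Algebra* (2002), Ch. XX §3, Thm. 3.1 (Euler–Poincaré maps). [Lang2002]
-/

open CategoryTheory CategoryTheory.Limits CategoryTheory.Pretriangulated Polynomial

universe v u

namespace Literature.Algebra.Homology.HopfTrace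

variable {K : Type u} [Field K] (T : Triangle (HomotopyCategory (ModuleCat.{v} K) (ComplexShape.up ℤ)))

/-- **Characteristic polynomials on cohomology are multiplicative on distinguished triangles of `K(Vect_K)`**: for `T ∈ distTriang` and an
endomorphism `e : T ⟶ T` of the triangle, `∏ᶠ n, χ(Hⁿ(e.hom₂))^{(−1)ⁿ} = (∏ᶠ n, χ(Hⁿ(e.hom₁))^{(−1)ⁿ}) · ∏ᶠ n, χ(Hⁿ(e.hom₃))^{(−1)ⁿ}` in `RatFunc K`
(finite-dimensional cohomology, finitely supported on the outer vertices). [cite: GortzWedhorn2023, Remark 23.62 (2)] [cite: Lang2002, Ch. XX §3, Thm. 3.1] -/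
theorem finprod_charpoly_homologyFunctor_hom₂_eq (hT : T ∈ distTriang _) (e : T ⟶ T)
    [∀ n : ℤ, Module.Finite K ((HomotopyCategory.homologyFunctor (ModuleCat.{v} K) (ComplexShape.up ℤ) n).obj T.obj₁)]
    [∀ n : ℤ, Module.Finite K ((HomotopyCategory.homologyFunctor (ModuleCat.{v} K) (ComplexShape.up ℤ) n).obj T.obj₂)]
    [∀ n : ℤ, Module.Finite K ((HomotopyCategory.homologyFunctor (ModuleCat.{v} K) (ComplexShape.up ℤ) n).obj T.obj₃)]
    (h₁ : (GradedObject.finrankSupport fun n => T.obj₁.as.homology n).Finite)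
    (h₃ : (GradedObject.finrankSupport fun n => T.obj₃.as.homology n).Finite) :
    ∏ᶠ n, algebraMap K[X] (RatFunc K)
        ((HomotopyCategory.homologyFunctor (ModuleCat.{v} K) (ComplexShape.up ℤ) n).map e.hom₂).hom.charpoly ^ (((ComplexShape.up ℤ).χ n : ℤ)) =
      (∏ᶠ n, algebraMap K[X] (RatFunc K)
        ((HomotopyCategory.homologyFunctor (ModuleCat.{v} K) (ComplexShape.up ℤ) n).map e.hom₁).hom.charpoly ^ (((ComplexShape.up ℤ).χ n : ℤ))) *
      ∏ᶠ n, algebraMap K[X] (RatFunc K)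
        ((HomotopyCategory.homologyFunctor (ModuleCat.{v} K) (ComplexShape.up ℤ) n).map e.hom₃).hom.charpoly ^ (((ComplexShape.up ℤ).χ n : ℤ)) := by
  classical
  set F := HomotopyCategory.homologyFunctor (ModuleCat.{v} K) (ComplexShape.up ℤ) 0
  have hf₁ : ∀ n : ℤ, Module.Finite K ((F.shift n).obj T.obj₁) := fun n =>
    inferInstanceAs (Module.Finite K ((HomotopyCategory.homologyFunctor (ModuleCat.{v} K) (ComplexShape.up ℤ) n).obj T.obj₁))
  have hf₂ : ∀ n : ℤ, Module.Finite K ((F.shift n).obj T.obj₂) := fun n =>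
    inferInstanceAs (Module.Finite K ((HomotopyCategory.homologyFunctor (ModuleCat.{v} K) (ComplexShape.up ℤ) n).obj T.obj₂))
  have hf₃ : ∀ n : ℤ, Module.Finite K ((F.shift n).obj T.obj₃) := fun n =>
    inferInstanceAs (Module.Finite K ((HomotopyCategory.homologyFunctor (ModuleCat.{v} K) (ComplexShape.up ℤ) n).obj T.obj₃))
  have hz : ∀ (X : HomotopyCategory (ModuleCat.{v} K) (ComplexShape.up ℤ)) (n : ℤ) [Module.Finite K ((F.shift n).obj X)],
      Module.finrank K (X.as.homology n) = 0 → Subsingleton ((F.shift n).obj X) := fun X n _ h0 => by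
    have h' : Module.finrank K ((F.shift n).obj X) = 0 := (Lefschetz.finrank_homologyFunctor_obj X n).trans h0
    exact Module.finrank_zero_iff.1 h'
  -- the unit of `K(X)` attached to a characteristic polynomial
  have hρ : ∀ {M : Type v} [AddCommGroup M] [Module K M] [Module.Finite K M] (f : M →ₗ[K] M),
      algebraMap K[X] (RatFunc K) f.charpoly ≠ 0 := fun f =>
    (map_ne_zero_iff _ (RatFunc.algebraMap_injective K)).2 f.charpoly_monic.ne_zero
  let U : ∀ {M : Type v} [AddCommGroup M] [Module K M] [Module.Finite K M], (M →ₗ[K] M) → (RatFunc K)ˣ :=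
    fun f => Units.mk0 _ (hρ f)
  have hU : ∀ {M : Type v} [AddCommGroup M] [Module K M] [Module.Finite K M] (f : M →ₗ[K] M),
      ((U f : (RatFunc K)ˣ) : RatFunc K) = algebraMap K[X] (RatFunc K) f.charpoly := fun f => rfl
  have hUm : ∀ {M N P : Type v} [AddCommGroup M] [Module K M] [Module.Finite K M] [AddCommGroup N] [Module K N] [Module.Finite K N]
      [AddCommGroup P] [Module K P] [Module.Finite K P] (f : M →ₗ[K] M) (g : N →ₗ[K] N) (k : P →ₗ[K] P),
      f.charpoly = g.charpoly * k.charpoly → U f = U g * U k := fun f g k h => Units.ext (by rw [Units.val_mul, hU, hU, hU, h, map_mul])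
  have hU1 : ∀ {M : Type v} [AddCommGroup M] [Module K M] [Module.Finite K M] (f : M →ₗ[K] M), Subsingleton M → U f = 1 :=
    fun f _ => Units.ext (by rw [hU, charpoly_eq_one_of_subsingleton, map_one, Units.val_one])
  -- the three exact pieces of the long exact sequence, with their endomorphisms
  let S₂ : ℤ → ShortComplex (ModuleCat.{v} K) := fun n => ShortComplex.mk _ _ (F.homologySequence_comp T hT n)
  let ψ₂ : ∀ n, S₂ n ⟶ S₂ n := fun n => ShortComplex.homMk ((F.shift n).map e.hom₁) ((F.shift n).map e.hom₂) ((F.shift n).map e.hom₃)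
    (by simp only [S₂, ← Functor.map_comp, e.comm₁]) (by simp only [S₂, ← Functor.map_comp, e.comm₂])
  let S₃ : ∀ n₀ n₁ : ℤ, n₀ + 1 = n₁ → ShortComplex (ModuleCat.{v} K) := fun n₀ n₁ h =>
    ShortComplex.mk _ _ (F.comp_homologySequenceδ T hT n₀ n₁ h)
  let ψ₃ : ∀ n₀ n₁ h, S₃ n₀ n₁ h ⟶ S₃ n₀ n₁ h := fun n₀ n₁ h => ShortComplex.homMk ((F.shift n₀).map e.hom₂) ((F.shift n₀).map e.hom₃)
    ((F.shift n₁).map e.hom₁) (by simp only [S₃, ← Functor.map_comp, e.comm₂]) (F.homologySequenceδ_naturality T T e n₀ n₁ h)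
  let S₁ : ∀ n₀ n₁ : ℤ, n₀ + 1 = n₁ → ShortComplex (ModuleCat.{v} K) := fun n₀ n₁ h =>
    ShortComplex.mk _ _ (F.homologySequenceδ_comp T hT n₀ n₁ h)
  let ψ₁ : ∀ n₀ n₁ h, S₁ n₀ n₁ h ⟶ S₁ n₀ n₁ h := fun n₀ n₁ h => ShortComplex.homMk ((F.shift n₀).map e.hom₃) ((F.shift n₁).map e.hom₁)
    ((F.shift n₁).map e.hom₂) (F.homologySequenceδ_naturality T T e n₀ n₁ h) (by simp only [S₁, ← Functor.map_comp, e.comm₁])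
  -- the restricted factors: along `Hⁿ(mor₁)`, along `Hⁿ(mor₂)`, along the connecting map `δ : Hⁿ⁰(T₃) → Hⁿ¹(T₁)`
  haveI := hf₁; haveI := hf₂; haveI := hf₃
  let R₁ : ℤ → (RatFunc K)ˣ := fun n => U (((ψ₂ n).τ₂.hom).restrict (mapsTo_range_f (S₂ n) (ψ₂ n)))
  let R₂ : ℤ → (RatFunc K)ˣ := fun n => U (((ψ₂ n).τ₃.hom).restrict (mapsTo_range_g (S₂ n) (ψ₂ n)))
  let d : ∀ n₀ n₁ : ℤ, n₀ + 1 = n₁ → (RatFunc K)ˣ := fun n₀ n₁ h =>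
    U (((ψ₃ n₀ n₁ h).τ₃.hom).restrict (mapsTo_range_g (S₃ n₀ n₁ h) (ψ₃ n₀ n₁ h)))
  have hd_congr : ∀ n₀ n₀' n₁ (h : n₀ + 1 = n₁) (h' : n₀' + 1 = n₁), n₀ = n₀' → d n₀ n₁ h = d n₀' n₁ h' := by
    rintro n₀ _ n₁ h h' rfl; rfl
  have hd1 : ∀ n₀ n₁ (h : n₀ + 1 = n₁), Module.finrank K (T.obj₁.as.homology n₁) = 0 → d n₀ n₁ h = 1 := fun n₀ n₁ h h0 => by
    haveI := hz T.obj₁ n₁ h0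
    exact hU1 _ inferInstance
  -- degreewise splitting (row `CharpolyHomologySequence`, three times)
  have eA : ∀ n, U ((F.shift n).map e.hom₂).hom = R₂ n * R₁ n := fun n =>
    hUm _ _ _ (charpoly_τ₂_eq_of_exact (F.homologySequence_exact₂ T hT n) (ψ₂ n))
  have eB : ∀ n : ℤ, U ((F.shift n).map e.hom₃).hom = d n (n + 1) rfl * R₂ n := fun n =>
    hUm _ _ _ (charpoly_τ₂_eq_of_exact (F.homologySequence_exact₃ T hT n (n + 1) rfl) (ψ₃ n (n + 1) rfl))
  have eC : ∀ n : ℤ, U ((F.shift n).map e.hom₁).hom = R₁ n * d (n - 1) n (by omega) := fun n =>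
    hUm _ _ _ (charpoly_τ₂_eq_of_exact (F.homologySequence_exact₁ T hT (n - 1) n (by omega)) (ψ₁ (n - 1) n (by omega)))
  -- finite supports
  have hsupp : ∀ (X : HomotopyCategory (ModuleCat.{v} K) (ComplexShape.up ℤ)) [∀ n, Module.Finite K ((F.shift n).obj X)] (f : X ⟶ X),
      (GradedObject.finrankSupport fun n => X.as.homology n).Finite → (fun n => U ((F.shift n).map f).hom).HasFiniteMulSupport :=
    fun X hXf f hX => hX.subset fun n hn => by
      by_contra hn'
      haveI := @hz X n (hXf n) (by simpa [GradedObject.finrankSupport] using hn')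
      exact hn (hU1 _ ‹_›)
  have s₁ := hsupp T.obj₁ e.hom₁ h₁; have s₃ := hsupp T.obj₃ e.hom₃ h₃
  have s₂ : (fun n => U ((F.shift n).map e.hom₂).hom).HasFiniteMulSupport := (h₁.union h₃).subset fun n hn => by
    by_contra hn'
    simp only [Set.mem_union, GradedObject.finrankSupport, Function.mem_support, ne_eq, not_or, not_not] at hn'
    haveI := hz T.obj₁ n hn'.1
    haveI := hz T.obj₃ n hn'.2
    haveI : Subsingleton ((F.shift n).obj T.obj₂) := Lefschetz.subsingleton_X₂_of_exact (S := S₂ n) (F.homologySequence_exact₂ T hT n)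
    exact hn (hU1 _ ‹_›)
  -- the abstract Euler–Poincaré principle in `(RatFunc K)ˣ` (row `EulerPoincarePrinciple`)
  have key := finprod_zpow_χ_eq_of_degreewise (c := ComplexShape.up ℤ)
    (fun n => U ((F.shift n).map e.hom₁).hom * U ((F.shift n).map e.hom₃).hom) (fun n => U ((F.shift n).map e.hom₂).hom)
    (fun n => d n (n + 1) rfl) (fun n => d (n - 1) n (by omega))
    (fun n => by rw [eA, eB, eC]; exact Units.ext (by simp only [Units.val_mul]; ring))
    (fun j hj => (hj (by simp)).elim) (fun i hi => (hi (by simp)).elim)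
    (fun i j hij => by
      have hij' : i + 1 = j := hij
      subst hij'
      exact hd_congr _ _ _ _ _ (by omega))
    s₂
    ((h₁.preimage (add_left_injective (1 : ℤ)).injOn).subset fun n hn => by
      simp only [GradedObject.finrankSupport, Function.mem_support, ne_eq, Set.mem_preimage] at hn ⊢
      exact fun h0 => hn (hd1 _ _ _ h0))
    (h₁.subset fun n hn => by
      simp only [GradedObject.finrankSupport, Function.mem_support, ne_eq] at hn ⊢
      exact fun h0 => hn (hd1 _ _ _ h0))
  -- read the units identity in `RatFunc K`
  have sz : ∀ {g : ℤ → (RatFunc K)ˣ}, g.HasFiniteMulSupport → (fun n => g n ^ (((ComplexShape.up ℤ).χ n : ℤ))).HasFiniteMulSupport :=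
    fun {g} hg => hg.subset fun i hi => by simp only [Function.mem_mulSupport, ne_eq] at hi ⊢; exact fun h => hi (by rw [h, one_zpow])
  have split : ∏ᶠ n, (U ((F.shift n).map e.hom₁).hom * U ((F.shift n).map e.hom₃).hom) ^ (((ComplexShape.up ℤ).χ n : ℤ)) =
      (∏ᶠ n, U ((F.shift n).map e.hom₁).hom ^ (((ComplexShape.up ℤ).χ n : ℤ))) *
        ∏ᶠ n, U ((F.shift n).map e.hom₃).hom ^ (((ComplexShape.up ℤ).χ n : ℤ)) := by
    rw [← finprod_mul_distrib (sz s₁) (sz s₃)]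
    exact finprod_congr fun i => mul_zpow _ _ _
  have h := congrArg (fun x : (RatFunc K)ˣ => (x : RatFunc K)) (key.symm.trans split)
  simp only [Units.val_mul, coe_finprod_units_zpow _ _ s₁, coe_finprod_units_zpow _ _ s₂, coe_finprod_units_zpow _ _ s₃, hU] at h
  exact h

end Literature.Algebra.Homology.HopfTrace
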